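import Literature.Analysis.FunctionSpaces.TorusTrigPoly
import Literature.Analysis.FunctionSpaces.TorusFourierCalculus
import Mathlib.MeasureTheory.Integral.Prod
import HarnessLib

/-!
# The transport flux into a weighted Galerkin energy as a PHYSICAL-SPACE double integral against the
# gradient kernel of the weight

Analysis/FunctionSpaces support file (one definition — the gradient kernel of a finitely supported Fourier
weight — and proofs; no named facts).  For a real vector field `w ∈ L²(𝕋^d; ℝ^d)`, a continuous drift
`b : 𝕋^d → ℝ^d` and real weights `ω` on a finite frequency set `F`, the transport flux of the weighted
Galerkin identity (`FluidPDE.PassiveVectorTensorWeightedGalerkinIdentity`, Fourier form, `A = 0`)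
`Fl(ω) = Σ_{k∈F} ω_k Re Σ_a 2πi k_a ⟪𝓕(b_a w)(k), ŵ(k)⟫`
is the double integral `∫∫ ⟨w(x), w(y)⟩ b(y)·∇K_ω(y − x) dx dy` against the GRADIENT KERNEL
`∇K_ω(z)_a = Σ_{k∈F} ω_k Re(2πi k_a e_k(z))` of the weight (`K_ω = Σ ω_k Re e_k`; product ↔ convolution:
`⟪𝓕(b_a w)(k), ŵ(k)⟫ = ∫∫ e_k(y) e_{−k}(x) b_a(y) ⟨w(x), w(y)⟩`, Fubini).  This puts the flux in the
form in which the drift is a FUNCTION (so that its Lipschitz constant, not a Wiener norm of its coefficients,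
controls the commutator with the multiplier — DiPerna–Lions' commutator lemma, Constantin–E–Titi's identity);
the symmetrisation `Fl(ω) = ½∫∫⟨w(x),w(y)⟩(b(y) − b(x))·∇K_ω(y−x)`, the double-difference form
`Fl(ω) = −¼∫∫|w(x) − w(y)|²(b(y) − b(x))·∇K_ω(y−x)` for weakly divergence-free `b`, and the Lipschitz bound
are the companion file `TorusTransportFluxSymm`.

* `fluxKernelGrad F ω a` — the gradient kernel; continuous, bounded, ODD, zero mean;
* `inner_mFourierCoeff_smul_eq_integral_prod` — the modal pairing as a double integral;
* `weightedFlux_eq_integral_prod` — the weighted flux as a double integral against `∇K_ω`.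

Consumer: cell `ad-ideate`, K1L_D `stmt-AnomalousDissipation-27980`, W3-E `stub_effectiveFrameEnergyL` (i): the
two-weight Lyapunov functional along the LAGRANGIAN carrier, whose gradient Wiener norm is inflated (phase
modulation) while its Lipschitz constant is the strain rate (crux memo `Lines/onelevel-W3E-k3l-lyapunov.md`).

## Mathlib / tree search
Tree: `TorusTrigPoly` (`integral_mFourier`, `integral_mFourier_neg_mul_coord`), `TorusFourierCalculus.mFourier_apply_add`,
`TorusCommutatorEstimate.convolution_mul_sub_mul_convolution` (the mollifier version of the double difference),
`Fourier/LatticeTransportFluxSymm` (the lattice version, Wiener constant).  Mathlib: `integral_prod_mul`,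
`Integrable.mul_prod`, `Measure.volume_eq_prod`, `integral_re`, `integral_conj`.

## References
* R. J. DiPerna, P.-L. Lions, Invent. Math. 98 (1989), §II.1, Lemma II.1. [`DiPernaLions1989`]
* P. Constantin, W. E, E. S. Titi, Comm. Math. Phys. 165 (1994), (9)–(10). [`ConstantinETiti1994`]
-/

noncomputable section

open MeasureTheory Set Filter Complex UnitAddTorus Function
open scoped ENNReal InnerProductSpace ComplexConjugate

namespace Literature.Analysis.FunctionSpaces

namespace Torus

variable {d : Type*} [Fintype d]

/-! ## §1 The gradient kernel of a finitely supported weight -/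

/-- **The gradient kernel of a Fourier weight**: `∇K_ω(z)_a = Σ_{k∈F} ω_k Re(2πi k_a e_k(z))`, the `a`-th
partial derivative of the real trigonometric polynomial `K_ω(z) = Σ_{k∈F} ω_k Re e_k(z)` whose convolution is
the multiplier `ω(D)` on real fields. [cite: DiPernaLions1989, §II.1 Lemma II.1] -/
def fluxKernelGrad (F : Finset (d → ℤ)) (ω : (d → ℤ) → ℝ) (a : d) (z : UnitAddTorus d) : ℝ :=
  ∑ k ∈ F, ω k * (2 * Real.pi * I * (k a : ℂ) * mFourier k z).re

/-- The gradient kernel is continuous (a trigonometric polynomial). [cite: Grafakos2014, §3.1.1] -/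
theorem continuous_fluxKernelGrad (F : Finset (d → ℤ)) (ω : (d → ℤ) → ℝ) (a : d) :
    Continuous (fluxKernelGrad F ω a) := by
  unfold fluxKernelGrad
  refine continuous_finsetSum _ fun k _ => continuous_const.mul ?_
  exact Complex.continuous_re.comp (continuous_const.mul (mFourier k).continuous)

/-- `|e_k(z)| = 1` (file-local copy of `TorusRieszFischerParam.norm_mFourier_apply`). [folklore] -/
private theorem norm_mFourier_apply' (n : d → ℤ) (x : UnitAddTorus d) : ‖mFourier n x‖ = 1 := by
  simp [mFourier]

/-- `e_k(y − x) = e_k(y) e_{−k}(x)`. [folklore] -/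
private theorem mFourier_sub_eq (k : d → ℤ) (x y : UnitAddTorus d) :
    mFourier k (y - x) = mFourier k y * mFourier (-k) x := by
  have h1 : mFourier k (y - x) * mFourier k x = mFourier k y := by
    rw [← mFourier_apply_add, sub_add_cancel]
  have h2 : mFourier k x * mFourier (-k) x = 1 := by
    rw [mFourier_neg, Complex.mul_conj, Complex.normSq_eq_norm_sq, norm_mFourier_apply']
    simp
  calc mFourier k (y - x) = mFourier k (y - x) * (mFourier k x * mFourier (-k) x) := by rw [h2, mul_one]
    _ = mFourier k y * mFourier (-k) x := by rw [← mul_assoc, h1]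

/-- The gradient kernel is bounded: `|∇K_ω(z)_a| ≤ Σ_k |ω_k| 2π |k_a|` (`|e_k| = 1`). [cite: Grafakos2014, §3.1.1] -/
theorem abs_fluxKernelGrad_le (F : Finset (d → ℤ)) (ω : (d → ℤ) → ℝ) (a : d) (z : UnitAddTorus d) :
    |fluxKernelGrad F ω a z| ≤ ∑ k ∈ F, |ω k| * (2 * Real.pi * |(k a : ℝ)|) := by
  unfold fluxKernelGrad
  refine (Finset.abs_sum_le_sum_abs _ _).trans (Finset.sum_le_sum fun k _ => ?_)
  rw [abs_mul]
  refine mul_le_mul_of_nonneg_left ((Complex.abs_re_le_norm _).trans ?_) (abs_nonneg _)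
  have h2pi : ‖(2 * Real.pi : ℂ)‖ = 2 * Real.pi := by
    rw [show (2 * Real.pi : ℂ) = ((2 * Real.pi : ℝ) : ℂ) by push_cast; ring, Complex.norm_real, Real.norm_eq_abs,
      abs_of_pos Real.two_pi_pos]
  rw [norm_mul, norm_mul, norm_mul, Complex.norm_I, mul_one, Complex.norm_intCast, h2pi, norm_mFourier_apply',
    mul_one]

/-- `e_k(0) = 1`. [folklore] -/
private theorem mFourier_apply_zero' (k : d → ℤ) : mFourier k (0 : UnitAddTorus d) = 1 := by
  have h := mFourier_apply_add k (0 : UnitAddTorus d) 0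
  rw [add_zero] at h
  have hne : mFourier k (0 : UnitAddTorus d) ≠ 0 := by
    intro h0
    have := norm_mFourier_apply' k (0 : UnitAddTorus d)
    rw [h0, norm_zero] at this
    exact zero_ne_one this
  exact (mul_eq_left₀ hne).1 h.symm

/-- `e_k(−z) = conj e_k(z)`. [folklore] -/
private theorem mFourier_apply_neg' (k : d → ℤ) (z : UnitAddTorus d) : mFourier k (-z) = conj (mFourier k z) := by
  have := mFourier_sub_eq k z 0
  rw [zero_sub, mFourier_apply_zero', one_mul, mFourier_neg] at this
  exact this

/-- `Re(c·i·w̄) = −Re(c·i·w)` for real `c`. [folklore] -/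
private theorem re_ofReal_mul_I_mul_conj (c : ℝ) (w : ℂ) : ((c : ℂ) * I * conj w).re = -((c : ℂ) * I * w).re := by
  simp [Complex.mul_re, Complex.mul_im]

/-- The gradient kernel is ODD: `∇K_ω(−z) = −∇K_ω(z)` (`e_k(−z) = conj e_k(z)`). [cite: Grafakos2014, §3.1.1] -/
theorem fluxKernelGrad_neg (F : Finset (d → ℤ)) (ω : (d → ℤ) → ℝ) (a : d) (z : UnitAddTorus d) :
    fluxKernelGrad F ω a (-z) = -fluxKernelGrad F ω a z := by
  unfold fluxKernelGrad
  rw [← Finset.sum_neg_distrib]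
  refine Finset.sum_congr rfl fun k _ => ?_
  rw [mFourier_apply_neg', ← mul_neg]
  congr 1
  have e1 : 2 * Real.pi * I * (k a : ℂ) * conj (mFourier k z) =
      ((2 * Real.pi * (k a : ℝ) : ℝ) : ℂ) * I * conj (mFourier k z) := by push_cast; ring
  have e2 : 2 * Real.pi * I * (k a : ℂ) * mFourier k z = ((2 * Real.pi * (k a : ℝ) : ℝ) : ℂ) * I * mFourier k z := by
    push_cast; ring
  rw [e1, e2]
  exact re_ofReal_mul_I_mul_conj _ _

/-- The gradient kernel has zero mean: `∫ ∇K_ω(z)_a dz = 0` (`∫ e_k = δ_{k0}` and the `k = 0` term carries `k_a = 0`). [cite: Grafakos2014, §3.1.1 (3.1.5)] -/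
theorem integral_fluxKernelGrad (F : Finset (d → ℤ)) (ω : (d → ℤ) → ℝ) (a : d) :
    ∫ z, fluxKernelGrad F ω a z = 0 := by
  unfold fluxKernelGrad
  rw [integral_finsetSum _ fun k _ => ?_]
  · refine Finset.sum_eq_zero fun k _ => ?_
    rw [integral_const_mul]
    have hint : Integrable (fun z : UnitAddTorus d => 2 * Real.pi * I * (k a : ℂ) * mFourier k z) volume :=
      (continuous_const.mul (mFourier k).continuous).integrable_of_hasCompactSupport
        (HasCompactSupport.of_compactSpace _)
    have hre : ∫ z, (2 * Real.pi * I * (k a : ℂ) * mFourier k z).re = (∫ z, 2 * Real.pi * I * (k a : ℂ) * mFourier k z).re := by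
      have := integral_re hint
      simpa using this
    rw [hre, integral_const_mul, integral_mFourier]
    by_cases hk : k = 0
    · subst hk; simp
    · simp [hk]
  · exact ((continuous_const.mul (Complex.continuous_re.comp (continuous_const.mul (mFourier k).continuous))).integrable_of_hasCompactSupport
      (HasCompactSupport.of_compactSpace _))

/-! ## §2 The Fourier pairing `⟪𝓕(b_a w)(k), ŵ(k)⟫` as a double integral -/

section Pairing

variable {w b : UnitAddTorus d → EuclideanSpace ℝ d}

/-- `|v_a| ≤ ‖v‖` on `ℝ^d`. [folklore] -/
private theorem abs_apply_le_norm' (v : EuclideanSpace ℝ d) (a : d) : |v a| ≤ ‖v‖ := by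
  have h := PiLp.norm_apply_le v a
  rwa [Real.norm_eq_abs] at h

/-- A continuous field times an `L²` field is integrable. [folklore] -/
private theorem integrable_smul_of_continuous (hw : MemLp w 2 volume) (hb : Continuous b) (a : d) :
    Integrable (fun x => b x a • w x) volume := by
  obtain ⟨C, hC⟩ := (isCompact_univ.image hb).isBounded.exists_norm_le
  have hba : Continuous fun x => b x a := (PiLp.continuous_apply 2 (fun _ : d => ℝ) a).comp hb
  refine Integrable.mono' ((hw.integrable one_le_two).norm.const_mul C) (hba.aestronglyMeasurable.smul hw.1)
    (ae_of_all _ fun x => ?_)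
  rw [norm_smul, Real.norm_eq_abs]
  exact mul_le_mul_of_nonneg_right ((abs_apply_le_norm' (b x) a).trans (hC _ ⟨x, Set.mem_univ _, rfl⟩))
    (norm_nonneg _)

/-- **The modal transport pairing as a double integral**: for `w ∈ L²`, `b` continuous, every `k` and `a`,
`⟪𝓕(b_a w)(k), ŵ(k)⟫_ℂ = ∫∫ e_k(y) e_{−k}(x) b_a(y) ⟨w(x), w(y)⟩ dx dy`.
[cite: DiPernaLions1989, §II.1 Lemma II.1] -/
theorem inner_mFourierCoeff_smul_eq_integral_prod (hw : MemLp w 2 volume) (hb : Continuous b) (k : d → ℤ) (a : d) :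
    ⟪mFourierCoeff (EuclideanSpace.complexify ∘ fun x => b x a • w x) k,
        mFourierCoeff (EuclideanSpace.complexify ∘ w) k⟫_ℂ =
      ∫ z : UnitAddTorus d × UnitAddTorus d, mFourier k z.2 * mFourier (-k) z.1 *
        ((b z.2 a : ℝ) : ℂ) * ((⟪w z.1, w z.2⟫_ℝ : ℝ) : ℂ) := by
  have hwi : Integrable w volume := hw.integrable one_le_two
  have hbwi : Integrable (fun x => b x a • w x) volume := integrable_smul_of_continuous hw hb a
  -- componentwise: `⟪B_i, W_i⟫ = W_i · conj B_i`
  rw [PiLp.inner_apply]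
  have hco : ∀ i, ⟪mFourierCoeff (EuclideanSpace.complexify ∘ fun x => b x a • w x) k i,
      mFourierCoeff (EuclideanSpace.complexify ∘ w) k i⟫_ℂ =
      (∫ x, mFourier (-k) x * ((w x i : ℝ) : ℂ)) * ∫ y, mFourier k y * ((b y a * w y i : ℝ) : ℂ) := by
    intro i
    rw [RCLike.inner_apply, ← integral_mFourier_neg_mul_coord hwi, ← integral_mFourier_neg_mul_coord hbwi,
      ← integral_conj]
    congr 1
    refine integral_congr_ae (ae_of_all _ fun y => ?_)
    simp only [map_mul, mFourier_neg, starRingEnd_self_apply, WithLp.ofLp_smul, Pi.smul_apply, smul_eq_mul,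
      Complex.ofReal_mul, Complex.conj_ofReal]
  simp_rw [hco]
  -- each product of integrals is a product integral
  have hprod : ∀ i, (∫ x, mFourier (-k) x * ((w x i : ℝ) : ℂ)) * (∫ y, mFourier k y * ((b y a * w y i : ℝ) : ℂ)) =
      ∫ z : UnitAddTorus d × UnitAddTorus d, (mFourier (-k) z.1 * ((w z.1 i : ℝ) : ℂ)) *
        (mFourier k z.2 * ((b z.2 a * w z.2 i : ℝ) : ℂ)) := by
    intro i
    rw [Measure.volume_eq_prod, ← integral_prod_mul]
  simp_rw [hprod]
  -- integrability of the terms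
  have hwi' : ∀ i, Integrable (fun x => mFourier (-k) x * ((w x i : ℝ) : ℂ)) volume := by
    intro i
    have h1 : Integrable (fun x => ((w x i : ℝ) : ℂ)) volume := (hwi.eval_piLp i).ofReal
    exact h1.bdd_mul (mFourier (-k)).continuous.aestronglyMeasurable
      (ae_of_all _ fun x => (norm_mFourier_apply' (-k) x).le)
  have hbwi' : ∀ i, Integrable (fun y => mFourier k y * ((b y a * w y i : ℝ) : ℂ)) volume := by
    intro i
    have h1 : Integrable (fun y => ((b y a * w y i : ℝ) : ℂ)) volume := by
      have h0 : Integrable (fun y => (((b y a • w y) i : ℝ) : ℂ)) volume := (hbwi.eval_piLp i).ofReal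
      refine h0.congr (ae_of_all _ fun y => ?_)
      simp
    exact h1.bdd_mul (mFourier k).continuous.aestronglyMeasurable (ae_of_all _ fun x => (norm_mFourier_apply' k x).le)
  have hterm : ∀ i, Integrable (fun z : UnitAddTorus d × UnitAddTorus d => (mFourier (-k) z.1 * ((w z.1 i : ℝ) : ℂ)) *
      (mFourier k z.2 * ((b z.2 a * w z.2 i : ℝ) : ℂ))) volume := by
    intro i
    rw [Measure.volume_eq_prod]
    exact (hwi' i).mul_prod (hbwi' i)
  rw [← integral_finsetSum _ fun i _ => hterm i]
  refine integral_congr_ae (ae_of_all _ fun z => ?_)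
  -- pointwise: `Σ_i e_{-k}(x) w_i(x) e_k(y) b_a(y) w_i(y) = e_k(y) e_{-k}(x) b_a(y) ⟨w(x), w(y)⟩`
  dsimp only
  rw [PiLp.inner_apply]
  push_cast
  rw [Finset.mul_sum]
  refine Finset.sum_congr rfl fun i _ => ?_
  simp only [Real.inner_apply]
  push_cast
  ring

/-- **The weighted transport flux as a double integral against the gradient kernel**:
`Σ_{k∈F} ω_k Re Σ_a 2πi k_a ⟪𝓕(b_a w)(k), ŵ(k)⟫ = ∫∫ ⟨w(x), w(y)⟩ b(y)·∇K_ω(y − x) dx dy`.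
[cite: DiPernaLions1989, §II.1 Lemma II.1] -/
theorem weightedFlux_eq_integral_prod (hw : MemLp w 2 volume) (hb : Continuous b) (F : Finset (d → ℤ))
    (ω : (d → ℤ) → ℝ) :
    ∑ k ∈ F, ω k * (∑ a, (2 * Real.pi * I * (k a : ℂ)) *
        ⟪mFourierCoeff (EuclideanSpace.complexify ∘ fun x => b x a • w x) k,
          mFourierCoeff (EuclideanSpace.complexify ∘ w) k⟫_ℂ).re =
      ∫ z : UnitAddTorus d × UnitAddTorus d,
        ⟪w z.1, w z.2⟫_ℝ * ∑ a, b z.2 a * fluxKernelGrad F ω a (z.2 - z.1) := by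
  have hwi : Integrable w volume := hw.integrable one_le_two
  obtain ⟨C, hC⟩ := (isCompact_univ.image hb).isBounded.exists_norm_le
  have hCb : ∀ y, ‖b y‖ ≤ C := fun y => hC _ ⟨y, Set.mem_univ _, rfl⟩
  -- the basic integrable product `(x, y) ↦ ‖w x‖ ‖w y‖`
  have hww : Integrable (fun z : UnitAddTorus d × UnitAddTorus d => ‖w z.1‖ * ‖w z.2‖) volume := by
    rw [Measure.volume_eq_prod]
    exact hwi.norm.mul_prod hwi.norm
  -- the integrand of each `(k, a)` and its integrability
  set Φ : (d → ℤ) → d → UnitAddTorus d × UnitAddTorus d → ℂ := fun k a z =>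
    mFourier k z.2 * mFourier (-k) z.1 * ((b z.2 a : ℝ) : ℂ) * ((⟪w z.1, w z.2⟫_ℝ : ℝ) : ℂ) with hΦ
  have hΦm : ∀ k a, AEStronglyMeasurable (Φ k a) volume := by
    intro k a
    have hba : Continuous fun y : UnitAddTorus d => b y a := (PiLp.continuous_apply 2 (fun _ : d => ℝ) a).comp hb
    refine ((((mFourier k).continuous.comp continuous_snd).aestronglyMeasurable.mul
      ((mFourier (-k)).continuous.comp continuous_fst).aestronglyMeasurable).mul
      (Complex.continuous_ofReal.comp (hba.comp continuous_snd)).aestronglyMeasurable).mul ?_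
    refine Complex.continuous_ofReal.comp_aestronglyMeasurable (AEStronglyMeasurable.inner ?_ ?_)
    · exact hw.1.comp_quasiMeasurePreserving (Measure.volume_eq_prod (α := UnitAddTorus d) (β := UnitAddTorus d) ▸
        Measure.quasiMeasurePreserving_fst)
    · exact hw.1.comp_quasiMeasurePreserving (Measure.volume_eq_prod (α := UnitAddTorus d) (β := UnitAddTorus d) ▸
        Measure.quasiMeasurePreserving_snd)
  have hΦi : ∀ k a, Integrable (Φ k a) volume := by
    intro k a
    refine Integrable.mono' (hww.const_mul C) (hΦm k a) (ae_of_all _ fun z => ?_)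
    simp only [hΦ, norm_mul, norm_mFourier_apply', one_mul, Complex.norm_real, Real.norm_eq_abs]
    have h1 : |b z.2 a| ≤ C := (abs_apply_le_norm' (b z.2) a).trans (hCb _)
    have h2 : |⟪w z.1, w z.2⟫_ℝ| ≤ ‖w z.1‖ * ‖w z.2‖ := abs_real_inner_le_norm _ _
    exact mul_le_mul h1 h2 (abs_nonneg _) ((abs_nonneg _).trans h1)
  have hsumi : ∀ k, Integrable (fun z : UnitAddTorus d × UnitAddTorus d => ∑ a, (2 * Real.pi * I * (k a : ℂ)) * Φ k a z)
      volume := fun k => integrable_finsetSum _ fun a _ => (hΦi k a).const_mul _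
  -- rewrite the pairings and pull the finite sums / scalars / real parts through the integral
  have step : ∀ k ∈ F, ω k * (∑ a, (2 * Real.pi * I * (k a : ℂ)) *
      ⟪mFourierCoeff (EuclideanSpace.complexify ∘ fun x => b x a • w x) k,
        mFourierCoeff (EuclideanSpace.complexify ∘ w) k⟫_ℂ).re =
      ∫ z : UnitAddTorus d × UnitAddTorus d, ω k * (∑ a, (2 * Real.pi * I * (k a : ℂ)) * Φ k a z).re := by
    intro k _
    have e1 : ∑ a, (2 * Real.pi * I * (k a : ℂ)) *
        ⟪mFourierCoeff (EuclideanSpace.complexify ∘ fun x => b x a • w x) k,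
          mFourierCoeff (EuclideanSpace.complexify ∘ w) k⟫_ℂ =
        ∫ z : UnitAddTorus d × UnitAddTorus d, ∑ a, (2 * Real.pi * I * (k a : ℂ)) * Φ k a z := by
      rw [integral_finsetSum _ fun a _ => (hΦi k a).const_mul _]
      refine Finset.sum_congr rfl fun a _ => ?_
      rw [integral_const_mul, inner_mFourierCoeff_smul_eq_integral_prod hw hb k a]
    have hre := integral_re (hsumi k)
    simp only [RCLike.re_to_complex] at hre
    rw [e1, ← hre, ← integral_const_mul]
  have hki : ∀ k, Integrable (fun z : UnitAddTorus d × UnitAddTorus d =>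
      ω k * (∑ a, (2 * Real.pi * I * (k a : ℂ)) * Φ k a z).re) volume := fun k => by
    simpa using ((hsumi k).re).const_mul (ω k)
  rw [Finset.sum_congr rfl step, ← integral_finsetSum _ fun k _ => hki k]
  refine integral_congr_ae (ae_of_all _ fun z => ?_)
  -- pointwise identity
  simp only [hΦ, fluxKernelGrad, Finset.mul_sum, Complex.re_sum]
  rw [Finset.sum_comm]
  refine Finset.sum_congr rfl fun a _ => Finset.sum_congr rfl fun k _ => ?_
  rw [mFourier_sub_eq k z.1 z.2]
  have e : 2 * Real.pi * I * (k a : ℂ) * (mFourier k z.2 * mFourier (-k) z.1 * ((b z.2 a : ℝ) : ℂ) *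
      ((⟪w z.1, w z.2⟫_ℝ : ℝ) : ℂ)) =
      ((⟪w z.1, w z.2⟫_ℝ * b z.2 a : ℝ) : ℂ) * (2 * Real.pi * I * (k a : ℂ) * (mFourier k z.2 * mFourier (-k) z.1)) := by
    push_cast; ring
  rw [e, Complex.re_ofReal_mul]
  ring

end Pairing

end Torus

end Literature.Analysis.FunctionSpaces

end
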